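import Summits.AtomisticToContinuum.BoseEinsteinCondensation.Theorems.BECProbeMassFlowRecoilTransferOfMassFlow

/-!
# Skeleton v10 for crux `RecoilTransfer` (stmt-AtomisticToContinuum-12311) — line `registered` (= `birth`)

Route `BECProbeMassFlow` (`AtomisticToContinuum/BoseEinsteinCondensation`), crux #3 `RecoilTransfer`
("recoil costs at most ε"). Lead reshape (2026-08-17, v5/v6, lead c2) of the c1 lead's v3
(`Cruxes/RecoilTransfer/Lines/birth.lean`; stubs open there: `stub_nearMinimisersParallel` = Perron–Frobenius
for the mass-deformed tagged Hamiltonian `H_κ` at every `κ ∈ (0,1]`, and `stub_massFlow`), SAME composition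
idea — the probe-mass dial `κ = m/M ∈ (0, 1]` on the tagged family
`H_κ = -κΔ₀ - ∑_{j≥1} Δⱼ + ∑_{j≥1} v^per(xⱼ - x₀) + ∑_{1≤i<j} v^per(xᵢ - xⱼ)` (`taggedPeriodicEnergy v κ`),
running quantity `A = taggedZeroModeOccupation`, static anchor through the sector of total momentum `Q = 0`
— with the open part re-cut to what the tree can and cannot supply:

* the mass flow is stated ON THE ZERO-MOMENTUM SECTOR on both sides (`stub_massFlowZeroMomentum`): floors
  `A ≥ a` on the `Q = 0` near-minimisers of `H_κ`, `κ ∈ (0, κ₀]`, give the floor `A ≥ a - ε` on the `Q = 0`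
  near-minimisers of `H_1`. In the pinned frame (`stub_zeroMomentumLift/Descent`, landed) this is the crux
  proper in its sharpest form: ground states of `H_imp + κ P_bath²` versus `H_imp + P_bath²`,
  `P_bath = ∑_{j≥1} -i∇ⱼ`, `A = w₀ = ‖Π_{P_bath = 0} ·‖²`. No Perron–Frobenius input on either side.
* the passage from `Q = 0` near-minimisers to ALL near-minimisers is made at `κ = 1` ONLY, where `H_1` is the
  `(N+1)`-BOSON Hamiltonian (bosonic floor `taggedPeriodicGroundStateEnergy_one_eq`, proved). Three classes of
  profiles `v` (the composition case-splits): (a) LOCALLY BOUNDED on `(0, ∞)` (bounded, integrable or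
  non-integrable soft cores `r^{-p}`): Ky Fan gap `2E₀ < kyFanTwo` at every `(N, L)`, `L > 2R₀`, `E₀ < ⊤` —
  LANDED by the sibling crux (`kyFanGap_of_locallyBounded`, Faris–Simon off the collision set); (b) INTEGRABLE
  (possibly not locally bounded): `PeriodicGroundStateNondegenerateIntegrable_holds` (Reed–Simon XIII.48(a) on
  the torus); in both cases the tree's clustering from the gap (`exists_phase_integral_norm_sub_sq_le_of_kyFanGap`)
  and transfer (`le_condensateOccupation_nearMinimiser_of_clustering`) plus the landed Bose zero-momentum
  attainment (`stub_boseZeroMomentumAttain`, p156119) finish (`boseTransfer_one_of`, sorry-free); (c) HARD WALLS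
  (`∫ v = ∞` and not locally bounded: hard cores `⊤·1_{[0,a]}`, hard shells, …): the Ky Fan gap is NOT claimed
  (at fixed `(N, L)` it is false for tuned hard shells, and for plain hard cores it is the open hard-sphere
  connectivity "Lemma G"); instead the line asks only that Bose near-minimisers be `L²`-close to
  zero-total-momentum Bose near-minimisers (`hardWallNearZeroMomentum_of`, sorry-free from two stubs) — true
  even for a DEGENERATE ground level: `stub_groundStatesTranslationInvariant` (v6, D′α) says EVERY element of
  the maximal-form ground-state class `maxFormGroundStates v M L` is invariant under the diagonal translations
  `translateLp b` (a finite-dimensional sublattice of `L²` — closed under `|·|`, conjugation, translations — on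
  which a connected group acts by positivity-preserving lattice isometries is fixed pointwise: translations
  permute the finitely many disjoint atoms continuously, hence trivially; NO connectivity of the hard-sphere
  configuration space enters), and `stub_nearMinimisersNearZeroMomentum_of_invariant` (v6, D′β) turns this
  into the trial-state statement (compactness of the form embedding puts near-minimisers close to the
  ground-state class; finite-range maximal-form approximation by the `C¹` Bose core; projection onto zero total
  momentum by the linear translation average, which does not raise the energy). The `n₀`-floor then moves by
  the `2(N+1)‖·‖_{L²}` Lipschitz bound (`condensateOccupation_le_add_of_sq_dist_le`;
  `boseTransfer_one_of_nearZeroMomentum`, sorry-free).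

Landed and used by name: `stub_zeroMomentumLift` (A1, p145142), `stub_zeroMomentumDescent` (A2, p147854),
glued without loss in `staticEndpoint_zero_of`; `stub_boseZeroMomentumAttain` (B1′, p156119). Landed, no
longer on the critical path: `stub_zeroMomentumAttain` (tagged B1, p152367), `stub_occupationContinuity`
(B3, p149581). Retired by the reshapes: `stub_nearMinimisersParallel` (v3 B2: PF for `H_κ`, `κ < 1`,
anisotropic — no tree support), `stub_massFlow` (v3 C: restated on `Q = 0`), `stub_kyFanGapHardCore` (v4 D:
its locally-bounded half is the landed `kyFanGap_of_locallyBounded`, its hard-wall half is gap-free now),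
`stub_hardWallNearZeroMomentum` (v5 D′: split into D′α + D′β, glued in `hardWallNearZeroMomentum_of`).

v8 (2026-08-17, after wave 2): every stub except C′ has LANDED, and the whole sorry-free glue of v7 is now in
the tree as `Theorems/BECProbeMassFlowRecoilTransferBoseTransferOne.lean` (p160696: the `κ = 1` transfers,
`recoilTransfer_hardWallNearZeroMomentum`) and `Theorems/BECProbeMassFlowRecoilTransferOfMassFlow.lean`
(p161235: static endpoint, degenerate branch, `recoilTransfer_of_massFlowZeroMomentum : C′-body → RecoilTransfer`).
This skeleton is therefore the one-line composition of the landed reduction with the one open stub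
`stub_massFlowZeroMomentum` (the crux proper; see `Cruxes/RecoilTransfer/MassFlowAnalysis.md`).

v9 (2026-08-17, lead c3): composition UNCHANGED (one open stub, C′). What v9 adds is in the tree, not in this
file: `Theorems/BECProbeMassFlowRecoilTransferCompleteCondensation.lean` (p163242, `--supports`) proves the
statement-level sandwich — `recoilTransfer_of_completeCondensation : (complete torus BEC, inline) → RecoilTransfer`
(the crux's static-floor hypothesis is IDLE there: it only forces `c ≤ 1`, `recoilTransfer_floor_le_one`) and
`completeCondensation_of_cloudMomentumAtom : CloudMomentumAtom → RecoilTransfer → (complete torus BEC)`. Hence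
GIVEN the sibling crux, `RecoilTransfer ↔` complete condensation of the dilute periodic gas
(`recoilTransfer_iff_completeCondensation_of_cloudMomentumAtom`), and C′ — which implies the crux through the
landed reduction below — can be no easier than "complete BEC minus whatever CloudMomentumAtom is worth": C′ at
fixed `(N, ρ)` reads `Ā_N(1) ≥ liminf_{κ→0⁺} Ā_N(κ) - ε` for the least zero-mode weight `Ā_N(κ)` over the `Q = 0`
ground states of `H_κ` (the slack `δ` is quantified AFTER `N`, so no energy window survives), i.e. a comparison of
two off-diagonal-long-range-order plateaus (`G_1(t) = L³γ_Bose(t,0)` vs the Anderson overlap `G_0(t)` of pinned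
ground states a distance `t` apart, both box-averaged). The lead's census of handles (Hellmann–Feynman/concavity,
linear response of `Π_{P=0}` in `κ`, joint numerical range of `(H_imp, P_bath²)`, moments vs atom of the law of
`P_bath`, the slice `φ = L^{3/2}Ω(0,·)` of the Bose ground state — a pinned trial state with `w₀ = A(1)` EXACTLY but
pinned-energy excess `T(0) - T(1) = O(ρa)` intensive, far above the sub-gap slack `δ₁` — and the
orthogonality-catastrophe escape `¬hypothesis`, physically false in `d = 3`) is in `Cruxes/RecoilTransfer/C3-Census.md`.
The same open statement is met by a second route of the conjunct
(`Theorems/BECRichardsonGaudinBeliaevDeformationBoundComparisonOfCondensation.lean`,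
`beliaevDeformationBound_of_completeCondensation`): file it ONCE as a `@[conjecture]` bridge, do not re-line.

v10 (2026-08-17, lead c4): composition UNCHANGED (one open stub, C′; no wave — nothing delegable). What c4 adds:
(i) the STUB-level calibration: C′ → crux is the landed reduction below; the converse directions are NOT formal —
`RecoilTransfer → C′` has two gaps (C′'s hypothesis is a floor at each small `κ` with an UNCONTROLLED slack `δ(κ)`,
too weak to return the static floor through the lift, whose recoil cost is `κ·⟨P_bath²⟩ = O(κN·E_imp)`; and the
crux's conclusion lives on Bose near-minimisers while C′'s lives on tagged `Q = 0` near-minimisers of `H_1`), and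
`(complete condensation) → C′` needs exactly the second gap closed: simplicity of the ground state of the
`(N+1)`-body Hamiltonian in the TAGGED (bath-symmetric-only) sector, i.e. the tree's Perron–Frobenius stack
(`PeriodicWeighted*.lean`, hard-wired to `boseSymmetric`) re-run without the symmetry constraint (`∫v < ∞` /
locally bounded `v`), and for hard walls an exchange-connectivity input of "Lemma G" type that the translation trick
of D′α does not supply (a discrete group may permute the sublattice atoms). So C′ is formally AT LEAST the crux, and
modulo `CloudMomentumAtom` at least complete condensation; nobody should expect it to be easier.
(ii) `Theorems/BECProbeMassFlowRecoilTransferDetour.lean` (this lead): complete condensation + `BoundaryTransferWeak`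
close the conjunct with NEITHER XL crux (`boseEinsteinCondensation_of_completeCondensation`), and
`CloudMomentumAtom ∧ RecoilTransfer ↔ CloudMomentumAtom ∧ (complete condensation)` — the route factors through the
open problem of the conjunct in its strong form. (iii) Presearch 2026-08-17 (corpus + galaxy): thermodynamic-limit
BEC "still not within reach" (Junge, arXiv:2603.20776, p. 1; best scale `R ∼ a(ρa³)^{-3/4-η}`); no rigorous
residue-vs-mass theorem for an impurity in an interacting Bose gas. Verdict unchanged: file complete condensation
ONCE as a `@[conjecture]` bridge shared with `BeliaevDeformationBound` (route BECRichardsonGaudin); do not re-line,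
do not re-seat a lead on this line — gen 2 finds the same single stub.

`RecoilTransfer_of : RecoilTransfer` concludes the crux BY NAME using the stub BY NAME.
-/

noncomputable section

open MeasureTheory Filter
open scoped ENNReal NNReal

namespace Summit.AtomisticToContinuum.BoseEinsteinCondensation.Cruxes.RecoilTransfer.Birth

open Literature.MathematicalPhysics.QuantumManyBody
open Literature.MathematicalPhysics.QuantumManyBody.BoseGas
open Summit.AtomisticToContinuum.BoseEinsteinCondensation.Theses.BECProbeMassFlow
open Summit.AtomisticToContinuum.BoseEinsteinCondensation.Theorems

/-! ### Landed stubs (by name, for the record)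

* `stub_zeroMomentumLift` (A1, p145142), `stub_zeroMomentumDescent` (A2, p147854) — Theorems namespace;
* `stub_zeroMomentumAttain` (B1, p152367), `stub_occupationContinuity` (B3, p149581) — off the critical path;
* `stub_boseZeroMomentumAttain` (B1′, p156119);
* `stub_groundStatesTranslationInvariant` (D′α, p159906; sublattice files p158872, p159301);
* `stub_nearMinimisersNearZeroMomentum_of_invariant` (D′β, p158523);
* glue: `recoilTransfer_hardWallNearZeroMomentum` (p160696), `recoilTransfer_of_massFlowZeroMomentum` (p161235).
-/

/-! ### The open stub -/

/-- **Stub C′ — mass flow on the zero-momentum sector (recoil costs at most `ε`; LOAD-BEARING, XL: the crux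
proper).** At low density, eventually in `N`: if for all sufficiently small mass ratios `κ ∈ (0, κ₀]` the
zero-total-momentum near-minimisers of `H_κ` keep the tagged particle in the constant mode with weight `≥ a`,
then so do the zero-total-momentum near-minimisers of the equal-mass problem `H_1`, up to a loss `ε`:
`A ≥ a - ε`. Pinned-frame reading (through the landed `stub_zeroMomentumLift/Descent`: a `Q = 0` tagged state
IS `L^{-3/2}φ(Y - x₀𝟙)`, `⟨Ψ, H_κΨ⟩ = ⟨φ, (H_imp + κP_bath²)φ⟩`, `A(Ψ) = w₀(φ) = ‖Π_{P_bath=0}φ‖²`): the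
ground states of `H_imp + P_bath²` keep the zero-bath-momentum weight of the ground states of
`H_imp + κP_bath²`, `κ → 0⁺`, up to `ε` — two neighbouring variational problems on ONE space differing by
the positive operator `P_bath² = |∑_{j≥1}∇ⱼ|²`, which annihilates `ran Π_{P_bath=0}` and is `≥ (2π/L)²` off it.
One loop: `1 - A(κ) = ρ∫|v̂_k|²S_k(ω_k + κk²)⁻²d³k/(2π)³ = O((b/a)²√(ρa³))` uniformly in `κ ∈ [0, 1]`
(GuentherEtAl2021 (8), (14)); no comparison principle in the mass is claimed (Castella1996, RoschKopp1995),
only `ε`-closeness as `ρ → 0`. Hellmann–Feynman gives only `1 - A(1) ≤ ⟨P_bath²⟩₁ (L/2π)²`, useless on the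
thermodynamic torus (KineticGapLengthScales). No Perron–Frobenius content (both sides live on `Q = 0`).
[cite: GuentherEtAl2021, eqs. (4), (8), (14); arXiv:1610.02203 (m_B/m_I ∈ {0,1})] -/
theorem stub_massFlowZeroMomentum :
    ∀ v : ℝ → ℝ≥0∞, IsRepulsiveFiniteRange v → ∀ ε : ℝ, 0 < ε →
      ∃ ρ₀ : ℝ, 0 < ρ₀ ∧ ∀ ρ : ℝ, 0 < ρ → ρ < ρ₀ → ∀ᶠ N : ℕ in Filter.atTop,
        ∀ a : ℝ, ∀ κ₀ : ℝ, 0 < κ₀ → κ₀ ≤ 1 →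
          (∀ κ : ℝ, 0 < κ → κ ≤ κ₀ → ∃ δ : ℝ≥0∞, 0 < δ ∧
            ∀ Ψ : TaggedPeriodicTrialState N (sideLength ρ (N + 1)), HasTotalMomentum 0 Ψ.ψ →
              taggedPeriodicEnergy v κ Ψ ≤
                  taggedPeriodicGroundStateEnergy v κ N (sideLength ρ (N + 1)) + δ →
                ENNReal.ofReal a ≤ taggedZeroModeOccupation N (sideLength ρ (N + 1)) Ψ.ψ) →
          ∃ δ' : ℝ≥0∞, 0 < δ' ∧
            ∀ Ψ : TaggedPeriodicTrialState N (sideLength ρ (N + 1)), HasTotalMomentum 0 Ψ.ψ →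
              taggedPeriodicEnergy v 1 Ψ ≤
                  taggedPeriodicGroundStateEnergy v 1 N (sideLength ρ (N + 1)) + δ' →
                ENNReal.ofReal (a - ε) ≤ taggedZeroModeOccupation N (sideLength ρ (N + 1)) Ψ.ψ := by
  sorry

/-! ### Composition -/

/-- **Composition (the skeleton theorem).** Concludes the crux `RecoilTransfer` BY NAME from the one open
stub `stub_massFlowZeroMomentum` BY NAME through the landed reduction
`recoilTransfer_of_massFlowZeroMomentum` (p161235), which packages the landed stubs A1, A2, B1′, D′α, D′β and
the tree's Ky Fan gap / clustering / `n₀`-stability facts. [folklore] -/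
theorem RecoilTransfer_of :
    Summit.AtomisticToContinuum.BoseEinsteinCondensation.Theses.BECProbeMassFlow.RecoilTransfer :=
  recoilTransfer_of_massFlowZeroMomentum stub_massFlowZeroMomentum

end Summit.AtomisticToContinuum.BoseEinsteinCondensation.Cruxes.RecoilTransfer.Birth

end
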